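import Summits.CriticalPhenomena.PercolationContinuityZ3.Theorems.PercNearOneGluingNoHeavyConstsConditionedMarker
import HarnessLib

/-!
# The Y-split of MDL(X)′, part 3: the linked-marker inequality and a wider proved class   (PAPER-2 track (ii); seat `prim-consts-2`, gen 16)

builds on p205010 (kernel theorem, internal audit signed; external expert review pending).  Support file (`--supports stmt-CriticalPhenomena-4575`);
memo `run/shared/lean/prim/consts/FROM-prim-consts-2-g16-MARKER-SPLIT.md`.  Theorems only; no sorries; standard axioms.  Companion of
`…ConstsConditionedMarker.lean` (C2 ≥ 0) and `…ConstsMarkerSplit.lean` (the identity `K_N·MDLX = K·C2 − I·C0 + K·μ(T)·P1`, the conjecture S0).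

Notation: `D = {s↮X}`, `T = {y↮{s}∪X} ∩ D`, `Y = {s↔y}`, `N = Yᶜ`, `Z = {s↔z}`, `W = {y↔z}`; `F` a monotone functional of `C_s` with `0 ≤ F ≤ 1`;
`I_A = ∫_{D∩A} F`, `K_A = ∫_{D∩A}(1−F)`, `I = ∫_D F`, `K = ∫_D (1−F)`.

* `Consts.linkedMarker_ge` — **THEOREM (step 1 of C2, exported):** `(∫_{D∩Y} F)·(μ(T∩Z) + μ(T∩W)) ≤ (∫_{D∩Y∩Z} F)·μ(T)` for monotone `F ≥ 0`, i.e. for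
  `F = 1_U`: `ν(Z | U, Y) ≥ P(Z ∪ W | T) = p' + P(Z|T)` — conditioning on any increasing information about `C_s` together with `s↔y` makes `s↔z` at
  least as likely as "`z` is linked to `s` or to `y`" under three-way separation.  (BHK Thm 1.3 with sets for the source set `{s,y}`, plus the
  increasing/antitone companion `Consts.twoSource_sameSource_mixed`.)
* `Consts.mdlxJoint_of_markerBound` — **THEOREM: MDL(X)′ holds at every `F` with `I·C0 ≤ K·I_Y·Θ + K·μ(T)·P1`**, where
  `C0 = μ(T)K_N K_{Y∩Z} − (μ(T∩W)K_N + μ(T)K_{N∩Z})K_Y` (lower conditioned-marker slack), `Θ = K_N μ(T∩Z) − μ(T) K_{N∩Z} ≥ 0`,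
  `P1 = μ(D∩N) I_{N∩Z} − μ(D∩N∩Z) I_N ≥ 0`.  For `F = 1_U` the hypothesis reads `(a₀ − b₀ − p')·ν(Y|Uᶜ) ≤ (t − b₀)·ν(Y|U) + (b₁ − b₀)·ν(N|U)`
  (`a₀ = ν(Z|Uᶜ,Y)`, `b₀ = ν(Z|Uᶜ,N)`, `b₁ = ν(Z|U,N)`, `t = P(Z|T)`); it contains the class `C0 ≤ 0` of `Consts.mdlxJoint_of_lowerMarker_le` and, since
  `a₀ ≤ 1`, every `U` with `(1 − b₀ − p')ν(Y|Uᶜ) ≤ (t − b₀)ν(Y|U) + (b₁ − b₀)ν(N|U)`.  Coverage in the exact census (n = 5): ≈ 97 % of the vertex-measurable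
  up-events (562/581), ≈ 53 % of the edge-level ones (1 320/2 474) — versus 86 % / 30 % for `C0 ≤ 0` alone.  Proof: the split identity (re-derived inline),
  `C2 ≥ I_Y·Θ` (`linkedMarker_ge`), `P1 ≥ 0` (`Consts.markerPA_ge`).
[cite: VandenbergHaggstromKahn2005, Thm. 1.3 (p. 6), Thm. 1.4 (p. 7) with Remark 1 after Thm. 1.2 (p. 5)]
-/

noncomputable section

namespace Summit.CriticalPhenomena.PercolationContinuityZ3.Theorems

open MeasureTheory Set Literature.Probability.LatticeModels Literature.Probability.Percolation
open scoped Classical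

namespace Consts

variable {V : Type*} [Fintype V]

/-- **The linked-marker inequality.**  For monotone `F ≥ 0`: `(∫_{D∩Y} F)·(μ(T∩Z) + μ(T∩W)) ≤ (∫_{D∩Y∩Z} F)·μ(T)`; for `F = 1_U`:
`ν(Z | U, Y) ≥ P(Z ∪ W | T)`.  BHK Thm 1.3 with sets (source set `{s,y}` repelled from `X`) and its increasing/antitone companion.
[cite: VandenbergHaggstromKahn2005, Thm. 1.3 (p. 6) with Remark 1 after Thm. 1.2 (p. 5) — corollary derived here] -/
theorem linkedMarker_ge (w : Sym2 V → unitInterval) (s y z : V) (X : Set V) (F : Set (Sym2 V) → ℝ)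
    (hF : Monotone F) (hF0 : ∀ C, 0 ≤ F C) :
    (∫ ω in {ω : BondConfig V | ∀ x ∈ X, ¬ (openGraph ω).Reachable s x} ∩ openConn s y,
        F (openEdgeCluster ω s) ∂(prodBernoulli w)) *
      ((prodBernoulli w).real ({ω : BondConfig V | ∀ x ∈ insert s X, ¬ (openGraph ω).Reachable y x} ∩
          {ω | ∀ x ∈ X, ¬ (openGraph ω).Reachable s x} ∩ openConn s z) +
        (prodBernoulli w).real ({ω : BondConfig V | ∀ x ∈ insert s X, ¬ (openGraph ω).Reachable y x} ∩
          {ω | ∀ x ∈ X, ¬ (openGraph ω).Reachable s x} ∩ openConn y z)) ≤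
    (∫ ω in {ω : BondConfig V | ∀ x ∈ X, ¬ (openGraph ω).Reachable s x} ∩ openConn s y ∩ openConn s z,
        F (openEdgeCluster ω s) ∂(prodBernoulli w)) *
      (prodBernoulli w).real ({ω : BondConfig V | ∀ x ∈ insert s X, ¬ (openGraph ω).Reachable y x} ∩
          {ω | ∀ x ∈ X, ¬ (openGraph ω).Reachable s x}) := by
  classical
  set μ := prodBernoulli w with hμ
  have hmeas : ∀ S : Set (BondConfig V), MeasurableSet S := fun _ => MeasurableSet.of_discrete
  have h0 : ∀ S : Set (BondConfig V), 0 ≤ μ.real S := fun _ => measureReal_nonneg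
  set D : Set (BondConfig V) := {ω | ∀ x ∈ X, ¬ (openGraph ω).Reachable s x} with hD
  set A : Set (BondConfig V) := {ω | ∀ x ∈ insert s X, ¬ (openGraph ω).Reachable y x} with hA
  set Yv : Set (BondConfig V) := openConn s y with hYv
  set Zv : Set (BondConfig V) := openConn s z with hZv
  set Wv : Set (BondConfig V) := openConn y z with hWv
  set E₁ : Set (BondConfig V) := {ω | ∀ a ∈ ({s, y} : Set V), ∀ x ∈ X, ¬ (openGraph ω).Reachable a x} with hE₁
  set E₂ : Set (BondConfig V) := {ω | ∀ a ∈ ({s} : Set V), ∀ x ∈ insert y X, ¬ (openGraph ω).Reachable a x} with hE₂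
  set Gy : Set (BondConfig V) := {ω | ∃ x ∈ X, (openGraph ω).Reachable y x} with hGy
  set T : Set (BondConfig V) := A ∩ D with hT
  set Gv : Set (BondConfig V) := D ∩ Gy with hGv
  set f : BondConfig V → ℝ := fun ω => F (openEdgeCluster ω s) with hf
  have mD : ∀ ω, ω ∈ D ↔ ∀ x ∈ X, ¬ (openGraph ω).Reachable s x := fun ω => Iff.rfl
  have mA : ∀ ω, ω ∈ A ↔ ¬ (openGraph ω).Reachable y s ∧ ∀ x ∈ X, ¬ (openGraph ω).Reachable y x := by
    intro ω; simp only [hA, mem_setOf_eq, mem_insert_iff, forall_eq_or_imp]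
  have mE₁ : ∀ ω, ω ∈ E₁ ↔ (∀ x ∈ X, ¬ (openGraph ω).Reachable s x) ∧ ∀ x ∈ X, ¬ (openGraph ω).Reachable y x := by
    intro ω; simp only [hE₁, mem_setOf_eq, mem_insert_iff, mem_singleton_iff, forall_eq_or_imp, forall_eq]
  have mE₂ : ∀ ω, ω ∈ E₂ ↔ ¬ (openGraph ω).Reachable s y ∧ ∀ x ∈ X, ¬ (openGraph ω).Reachable s x := by
    intro ω; simp only [hE₂, mem_setOf_eq, mem_singleton_iff, forall_eq, mem_insert_iff, forall_eq_or_imp]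
  have mY : ∀ ω, ω ∈ Yv ↔ (openGraph ω).Reachable s y := fun ω => Iff.rfl
  have mZ : ∀ ω, ω ∈ Zv ↔ (openGraph ω).Reachable s z := fun ω => Iff.rfl
  have mW : ∀ ω, ω ∈ Wv ↔ (openGraph ω).Reachable y z := fun ω => Iff.rfl
  have mGy : ∀ ω, ω ∈ Gy ↔ ∃ x ∈ X, (openGraph ω).Reachable y x := fun ω => Iff.rfl
  -- set identities
  have sDY : E₁ ∩ Yv = D ∩ Yv := by
    ext ω; simp only [mem_inter_iff, mE₁, mD, mY]
    constructor
    · rintro ⟨⟨h, -⟩, hsy⟩; exact ⟨h, hsy⟩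
    · rintro ⟨h, hsy⟩; exact ⟨⟨h, fun x hx hr => h x hx (hsy.trans hr)⟩, hsy⟩
  have sT : T = E₁ ∩ Yvᶜ := by
    ext ω; simp only [hT, mem_inter_iff, mA, mD, mE₁, mem_compl_iff, mY]
    constructor
    · rintro ⟨⟨hys, hyX⟩, hsX⟩; exact ⟨⟨hsX, hyX⟩, fun h => hys h.symm⟩
    · rintro ⟨⟨hsX, hyX⟩, hsy⟩; exact ⟨⟨fun h => hsy h.symm, hyX⟩, hsX⟩
  have sE₂ : E₂ = D ∩ Yvᶜ := by
    ext ω; simp only [mE₂, mem_inter_iff, mD, mem_compl_iff, mY]; tauto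
  have sDN : D ∩ Yvᶜ = T ∪ Gv := by
    ext ω; simp only [mem_inter_iff, mem_compl_iff, mem_union, sT, hGv, mE₁, mD, mY, mGy]
    constructor
    · rintro ⟨hsX, hsy⟩
      by_cases hyx : ∃ x ∈ X, (openGraph ω).Reachable y x
      · exact Or.inr ⟨hsX, hyx⟩
      · simp only [not_exists, not_and] at hyx; exact Or.inl ⟨⟨hsX, hyx⟩, hsy⟩
    · rintro (⟨⟨hsX, -⟩, hsy⟩ | ⟨hsX, ⟨x, hx, hr⟩⟩)
      · exact ⟨hsX, hsy⟩
      · exact ⟨hsX, fun hsy => hsX x hx (hsy.trans hr)⟩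
  have dDN : Disjoint T Gv := by
    rw [Set.disjoint_left]
    rintro ω hT' ⟨-, ⟨x, hx, hr⟩⟩
    rw [sT] at hT'
    exact ((mE₁ ω).1 hT'.1).2 x hx hr
  have sZW : E₁ ∩ Yvᶜ ∩ (Zv ∪ Wv) = T ∩ Zv ∪ T ∩ Wv := by
    rw [← sT, inter_union_distrib_left]
  have dZW : Disjoint (T ∩ Zv) (T ∩ Wv) := by
    rw [Set.disjoint_left]
    rintro ω ⟨hT', hsz⟩ ⟨-, hyz⟩
    rw [sT] at hT'
    exact hT'.2 ((show (openGraph ω).Reachable s z from hsz).trans (show (openGraph ω).Reachable y z from hyz).symm)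
  have sYZW : E₁ ∩ (Yv ∩ (Zv ∪ Wv)) = D ∩ Yv ∩ Zv := by
    rw [← sDY]
    ext ω; simp only [mem_inter_iff, mem_union, mY, mZ, mW]
    constructor
    · rintro ⟨h1, hsy, hzw⟩
      exact ⟨⟨h1, hsy⟩, hzw.elim id fun hyz => hsy.trans hyz⟩
    · rintro ⟨⟨h1, hsy⟩, hsz⟩; exact ⟨h1, hsy, Or.inl hsz⟩
  /- STEP 1: BHK Thm 1.3 with sets for the source set `{s,y}` repelled from `X`, functionals `Φ(K) = F(K)·1{s↔y in K}` and
     `H(K) = 1{s↔z or y↔z in K}`; then the increasing/antitone form for `H` and `1{s↮y in K}`. -/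
  set Φ : Set (Sym2 V) → ℝ := fun C => F C * (if (openGraph C).Reachable s y then 1 else 0) with hΦ
  set H : Set (Sym2 V) → ℝ := fun C => if (openGraph C).Reachable s z ∨ (openGraph C).Reachable y z then 1 else 0 with hH
  set Nf : Set (Sym2 V) → ℝ := fun C => if (openGraph C).Reachable s y then 0 else 1 with hNf
  have hΦm : Monotone Φ := by
    intro C C' h; simp only [hΦ]
    by_cases hc : (openGraph C).Reachable s y
    · rw [if_pos hc, if_pos (hc.mono (openGraph_mono h)), mul_one, mul_one]; exact hF h
    · rw [if_neg hc, mul_zero]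
      exact mul_nonneg (hF0 _) (by split_ifs <;> norm_num)
  have hHm : Monotone H := by
    intro C C' h; simp only [hH]
    by_cases hc : (openGraph C).Reachable s z ∨ (openGraph C).Reachable y z
    · rw [if_pos hc, if_pos (hc.imp (fun hr => hr.mono (openGraph_mono h)) (fun hr => hr.mono (openGraph_mono h)))]
    · rw [if_neg hc]; split_ifs <;> norm_num
  have hNfa : Antitone Nf := by
    intro C C' h; simp only [hNf]
    by_cases hc : (openGraph C).Reachable s y
    · rw [if_pos hc, if_pos (hc.mono (openGraph_mono h))]
    · rw [if_neg hc]; split_ifs <;> norm_num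
  have hH0 : ∀ C, 0 ≤ H C := fun C => by simp only [hH]; split_ifs <;> norm_num
  have hNf0 : ∀ C, 0 ≤ Nf C := fun C => by simp only [hNf]; split_ifs <;> norm_num
  -- reading the functionals on a configuration
  have rY : ∀ ω : BondConfig V, (openGraph (⋃ a ∈ ({s, y} : Set V), openEdgeCluster ω a)).Reachable s y ↔
      (openGraph ω).Reachable s y := fun ω => (KNSep.reachable_iff_cluster ω ({s, y} : Set V) (mem_insert s {y}) y).symm
  have rZW : ∀ ω : BondConfig V, ((openGraph (⋃ a ∈ ({s, y} : Set V), openEdgeCluster ω a)).Reachable s z ∨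
      (openGraph (⋃ a ∈ ({s, y} : Set V), openEdgeCluster ω a)).Reachable y z) ↔ ω ∈ Zv ∪ Wv := by
    intro ω
    rw [← KNSep.reachable_iff_cluster ω ({s, y} : Set V) (mem_insert s {y}) z,
      ← KNSep.reachable_iff_cluster ω ({s, y} : Set V) (mem_insert_of_mem s (mem_singleton y)) z]
    rfl
  have hΦω : ∀ ω : BondConfig V, Φ (⋃ a ∈ ({s, y} : Set V), openEdgeCluster ω a) = f ω * Yv.indicator 1 ω := by
    intro ω
    simp only [hΦ, rY]
    by_cases h : (openGraph ω).Reachable s y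
    · rw [if_pos h, indicator_of_mem (show ω ∈ Yv from h), Pi.one_apply, iUnion_pair_openEdgeCluster_eq h]
    · rw [if_neg h, indicator_of_notMem (show ω ∉ Yv from h), mul_zero, mul_zero]
  have hHω : ∀ ω : BondConfig V, H (⋃ a ∈ ({s, y} : Set V), openEdgeCluster ω a) = (Zv ∪ Wv).indicator 1 ω := by
    intro ω
    simp only [hH, rZW]
    by_cases h : ω ∈ Zv ∪ Wv
    · rw [if_pos h, indicator_of_mem h, Pi.one_apply]
    · rw [if_neg h, indicator_of_notMem h]
  have hNfω : ∀ ω : BondConfig V, Nf (⋃ a ∈ ({s, y} : Set V), openEdgeCluster ω a) = Yvᶜ.indicator 1 ω := by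
    intro ω
    simp only [hNf, rY]
    by_cases h : (openGraph ω).Reachable s y
    · rw [if_pos h, indicator_of_notMem (show ω ∉ Yvᶜ from fun h' => h' h)]
    · rw [if_neg h, indicator_of_mem (show ω ∈ Yvᶜ from h), Pi.one_apply]
  -- (1a) positive association of K = C_{s,y} given E₁
  have hQ := BHK2006_setClusterConditionalPositiveAssociation w ({s, y} : Set V) X Φ H hΦm hHm
  have hΦH : ∀ ω : BondConfig V, f ω * Yv.indicator 1 ω * (Zv ∪ Wv).indicator 1 ω =
      f ω * (Yv ∩ (Zv ∪ Wv)).indicator 1 ω := by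
    intro ω
    rw [mul_assoc]
    congr 1
    by_cases h1 : ω ∈ Yv
    · by_cases h2 : ω ∈ Zv ∪ Wv
      · rw [indicator_of_mem h1, indicator_of_mem h2, indicator_of_mem (mem_inter h1 h2), Pi.one_apply, mul_one]
      · rw [indicator_of_notMem h2, indicator_of_notMem (show ω ∉ Yv ∩ (Zv ∪ Wv) from fun h => h2 h.2), mul_zero]
    · rw [indicator_of_notMem h1, indicator_of_notMem (show ω ∉ Yv ∩ (Zv ∪ Wv) from fun h => h1 h.1), zero_mul]
  simp only [hΦω, hHω] at hQ
  simp only [hΦH] at hQ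
  change (∫ ω in E₁, f ω * Yv.indicator 1 ω ∂μ) * (∫ ω in E₁, (Zv ∪ Wv).indicator 1 ω ∂μ) ≤
    μ.real E₁ * ∫ ω in E₁, f ω * (Yv ∩ (Zv ∪ Wv)).indicator 1 ω ∂μ at hQ
  rw [setIntegral_mul_indicator_one, setIntegral_mul_indicator_one, TripodExchange.setIntegral_indicator_one_eq,
    sDY, sYZW] at hQ
  -- hQ : (∫_{D∩Y} f) * μ(E₁ ∩ (Z∪W)) ≤ μ(E₁) * ∫_{D∩Y∩Z} f
  -- (1b) increasing `H` against antitone `Nf` given E₁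
  have hM := twoSource_sameSource_mixed w ({s, y} : Set V) X X H Nf hHm hNfa hH0 hNf0
  simp only [Set.inter_self, Set.union_self, hHω, hNfω] at hM
  change (∫ ω in E₁, (Zv ∪ Wv).indicator 1 ω * Yvᶜ.indicator 1 ω ∂μ) * μ.real E₁ ≤
    (∫ ω in E₁, (Zv ∪ Wv).indicator 1 ω ∂μ) * ∫ ω in E₁, Yvᶜ.indicator 1 ω ∂μ at hM
  rw [TripodExchange.setIntegral_indicator_mul_indicator_eq, TripodExchange.setIntegral_indicator_one_eq,
    TripodExchange.setIntegral_indicator_one_eq] at hM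
  -- hM : μ(E₁ ∩ ((Z∪W) ∩ Yᶜ)) * μ(E₁) ≤ μ(E₁ ∩ (Z∪W)) * μ(E₁ ∩ Yᶜ)
  have e1 : E₁ ∩ ((Zv ∪ Wv) ∩ Yvᶜ) = T ∩ Zv ∪ T ∩ Wv := by
    rw [← sZW, inter_comm (Zv ∪ Wv) Yvᶜ, inter_assoc]
  rw [e1, measureReal_union dZW (hmeas _), ← sT] at hM
  -- STEP 1 combined: (∫_{D∩Y} f)·(μ(T∩Z)+μ(T∩W)) ≤ (∫_{D∩Y∩Z} f)·μ(T)
  have hIY0 : 0 ≤ ∫ ω in D ∩ Yv, f ω ∂μ := setIntegral_nonneg (hmeas _) fun ω _ => hF0 _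
  have hIYZ0 : 0 ≤ ∫ ω in D ∩ Yv ∩ Zv, f ω ∂μ := setIntegral_nonneg (hmeas _) fun ω _ => hF0 _
  have step1 : (∫ ω in D ∩ Yv, f ω ∂μ) * (μ.real (T ∩ Zv) + μ.real (T ∩ Wv)) ≤
      (∫ ω in D ∩ Yv ∩ Zv, f ω ∂μ) * μ.real T := by
    by_cases hE : μ.real E₁ = 0
    · have hT0 : μ.real T = 0 := le_antisymm ((measureReal_mono (by rw [sT]; exact inter_subset_left)).trans hE.le) (h0 _)
      have hTZ : μ.real (T ∩ Zv) = 0 := le_antisymm ((measureReal_mono inter_subset_left).trans hT0.le) (h0 _)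
      have hTW : μ.real (T ∩ Wv) = 0 := le_antisymm ((measureReal_mono inter_subset_left).trans hT0.le) (h0 _)
      rw [hT0, hTZ, hTW]; simp
    · have hEpos : 0 < μ.real E₁ := lt_of_le_of_ne (h0 _) (Ne.symm hE)
      -- (∫_{DY} f)(μTZ+μTW) μE₁ ≤ (∫_{DY} f) μ(E₁∩(Z∪W)) μT ≤ μE₁ (∫_{DYZ} f) μT
      have h2 : (∫ ω in D ∩ Yv, f ω ∂μ) * ((μ.real (T ∩ Zv) + μ.real (T ∩ Wv)) * μ.real E₁) ≤
          (∫ ω in D ∩ Yv, f ω ∂μ) * (μ.real (E₁ ∩ (Zv ∪ Wv)) * μ.real T) :=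
        mul_le_mul_of_nonneg_left hM hIY0
      have h3 : (∫ ω in D ∩ Yv, f ω ∂μ) * μ.real (E₁ ∩ (Zv ∪ Wv)) * μ.real T ≤
          μ.real E₁ * (∫ ω in D ∩ Yv ∩ Zv, f ω ∂μ) * μ.real T :=
        mul_le_mul_of_nonneg_right hQ (h0 _)
      have h4 : ((∫ ω in D ∩ Yv, f ω ∂μ) * (μ.real (T ∩ Zv) + μ.real (T ∩ Wv))) * μ.real E₁ ≤
          ((∫ ω in D ∩ Yv ∩ Zv, f ω ∂μ) * μ.real T) * μ.real E₁ := by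
        nlinarith [h2, h3]
      exact le_of_mul_le_mul_right h4 hEpos
  exact step1

/-- **THEOREM: MDL(X)′ on the marker-bound class.**  For monotone `F` with `0 ≤ F ≤ 1` and `K_N > 0`: if `I·C0 ≤ K·I_Y·Θ + K·μ(T)·P1`
(module docstring; for `F = 1_U`: `(a₀ − b₀ − p')ν(Y|Uᶜ) ≤ (t − b₀)ν(Y|U) + (b₁ − b₀)ν(N|U)`), then the inequality of `Consts.MDLXJoint` holds at `F`.
Contains the class `C0 ≤ 0` (`Consts.mdlxJoint_of_lowerMarker_le`).  Proof: the split identity `K_N·MDLX = K·C2 − I·C0 + K·μ(T)·P1`,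
`C2 ≥ I_Y·Θ` (`Consts.linkedMarker_ge`) and the hypothesis.
[cite: VandenbergHaggstromKahn2005, Thm. 1.3 (p. 6), Thm. 1.4 (p. 7) — corollary derived here] -/
theorem mdlxJoint_of_markerBound (w : Sym2 V → unitInterval) (s y z : V) (X : Set V) (F : Set (Sym2 V) → ℝ)
    (hF : Monotone F) (hF0 : ∀ C, 0 ≤ F C) (hF1 : ∀ C, F C ≤ 1)
    (hKN : 0 < (∫ ω in {ω : BondConfig V | ∀ x ∈ X, ¬ (openGraph ω).Reachable s x} ∩ (openConn s y)ᶜ, (1 - F (openEdgeCluster ω s)) ∂(prodBernoulli w)))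
    (hcond : (∫ ω in {ω : BondConfig V | ∀ x ∈ X, ¬ (openGraph ω).Reachable s x}, F (openEdgeCluster ω s) ∂(prodBernoulli w)) *
        ((prodBernoulli w).real ({ω : BondConfig V | ∀ x ∈ insert s X, ¬ (openGraph ω).Reachable y x} ∩
          {ω : BondConfig V | ∀ x ∈ X, ¬ (openGraph ω).Reachable s x}) * (∫ ω in {ω : BondConfig V | ∀ x ∈ X, ¬ (openGraph ω).Reachable s x} ∩ (openConn s y)ᶜ, (1 - F (openEdgeCluster ω s)) ∂(prodBernoulli w)) * (∫ ω in {ω : BondConfig V | ∀ x ∈ X, ¬ (openGraph ω).Reachable s x} ∩ openConn s y ∩ openConn s z, (1 - F (openEdgeCluster ω s)) ∂(prodBernoulli w)) -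
        ((prodBernoulli w).real ({ω : BondConfig V | ∀ x ∈ insert s X, ¬ (openGraph ω).Reachable y x} ∩
          {ω : BondConfig V | ∀ x ∈ X, ¬ (openGraph ω).Reachable s x} ∩ openConn y z) * (∫ ω in {ω : BondConfig V | ∀ x ∈ X, ¬ (openGraph ω).Reachable s x} ∩ (openConn s y)ᶜ, (1 - F (openEdgeCluster ω s)) ∂(prodBernoulli w)) + (prodBernoulli w).real ({ω : BondConfig V | ∀ x ∈ insert s X, ¬ (openGraph ω).Reachable y x} ∩
          {ω : BondConfig V | ∀ x ∈ X, ¬ (openGraph ω).Reachable s x}) * (∫ ω in {ω : BondConfig V | ∀ x ∈ X, ¬ (openGraph ω).Reachable s x} ∩ (openConn s y)ᶜ ∩ openConn s z, (1 - F (openEdgeCluster ω s)) ∂(prodBernoulli w))) * (∫ ω in {ω : BondConfig V | ∀ x ∈ X, ¬ (openGraph ω).Reachable s x} ∩ openConn s y, (1 - F (openEdgeCluster ω s)) ∂(prodBernoulli w))) ≤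
      (∫ ω in {ω : BondConfig V | ∀ x ∈ X, ¬ (openGraph ω).Reachable s x}, (1 - F (openEdgeCluster ω s)) ∂(prodBernoulli w)) * (∫ ω in {ω : BondConfig V | ∀ x ∈ X, ¬ (openGraph ω).Reachable s x} ∩ openConn s y, F (openEdgeCluster ω s) ∂(prodBernoulli w)) *
        ((∫ ω in {ω : BondConfig V | ∀ x ∈ X, ¬ (openGraph ω).Reachable s x} ∩ (openConn s y)ᶜ, (1 - F (openEdgeCluster ω s)) ∂(prodBernoulli w)) * (prodBernoulli w).real ({ω : BondConfig V | ∀ x ∈ insert s X, ¬ (openGraph ω).Reachable y x} ∩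
          {ω : BondConfig V | ∀ x ∈ X, ¬ (openGraph ω).Reachable s x} ∩ openConn s z) - (prodBernoulli w).real ({ω : BondConfig V | ∀ x ∈ insert s X, ¬ (openGraph ω).Reachable y x} ∩
          {ω : BondConfig V | ∀ x ∈ X, ¬ (openGraph ω).Reachable s x}) * (∫ ω in {ω : BondConfig V | ∀ x ∈ X, ¬ (openGraph ω).Reachable s x} ∩ (openConn s y)ᶜ ∩ openConn s z, (1 - F (openEdgeCluster ω s)) ∂(prodBernoulli w))) +
      (∫ ω in {ω : BondConfig V | ∀ x ∈ X, ¬ (openGraph ω).Reachable s x}, (1 - F (openEdgeCluster ω s)) ∂(prodBernoulli w)) * (prodBernoulli w).real ({ω : BondConfig V | ∀ x ∈ insert s X, ¬ (openGraph ω).Reachable y x} ∩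
          {ω : BondConfig V | ∀ x ∈ X, ¬ (openGraph ω).Reachable s x}) *
        ((prodBernoulli w).real ({ω : BondConfig V | ∀ x ∈ X, ¬ (openGraph ω).Reachable s x} ∩ (openConn s y)ᶜ) * (∫ ω in {ω : BondConfig V | ∀ x ∈ X, ¬ (openGraph ω).Reachable s x} ∩ (openConn s y)ᶜ ∩ openConn s z, F (openEdgeCluster ω s) ∂(prodBernoulli w)) - (prodBernoulli w).real ({ω : BondConfig V | ∀ x ∈ X, ¬ (openGraph ω).Reachable s x} ∩ (openConn s y)ᶜ ∩ openConn s z) * (∫ ω in {ω : BondConfig V | ∀ x ∈ X, ¬ (openGraph ω).Reachable s x} ∩ (openConn s y)ᶜ, F (openEdgeCluster ω s) ∂(prodBernoulli w)))) :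
    (prodBernoulli w).real ({ω : BondConfig V | ∀ x ∈ insert s X, ¬ (openGraph ω).Reachable y x} ∩
          {ω : BondConfig V | ∀ x ∈ X, ¬ (openGraph ω).Reachable s x} ∩ openConn y z) *
        ((prodBernoulli w).real {ω : BondConfig V | ∀ x ∈ X, ¬ (openGraph ω).Reachable s x} *
            (∫ ω in {ω : BondConfig V | ∀ x ∈ X, ¬ (openGraph ω).Reachable s x} ∩ openConn s y, F (openEdgeCluster ω s) ∂(prodBernoulli w)) -
          (∫ ω in {ω : BondConfig V | ∀ x ∈ X, ¬ (openGraph ω).Reachable s x}, F (openEdgeCluster ω s) ∂(prodBernoulli w)) *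
            (prodBernoulli w).real ({ω : BondConfig V | ∀ x ∈ X, ¬ (openGraph ω).Reachable s x} ∩ openConn s y)) ≤
      (prodBernoulli w).real ({ω : BondConfig V | ∀ x ∈ insert s X, ¬ (openGraph ω).Reachable y x} ∩
          {ω : BondConfig V | ∀ x ∈ X, ¬ (openGraph ω).Reachable s x}) *
        ((prodBernoulli w).real {ω : BondConfig V | ∀ x ∈ X, ¬ (openGraph ω).Reachable s x} *
            (∫ ω in {ω : BondConfig V | ∀ x ∈ X, ¬ (openGraph ω).Reachable s x} ∩ openConn s z, F (openEdgeCluster ω s) ∂(prodBernoulli w)) -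
          (∫ ω in {ω : BondConfig V | ∀ x ∈ X, ¬ (openGraph ω).Reachable s x}, F (openEdgeCluster ω s) ∂(prodBernoulli w)) *
            (prodBernoulli w).real ({ω : BondConfig V | ∀ x ∈ X, ¬ (openGraph ω).Reachable s x} ∩ openConn s z)) := by
  classical
  set μ := prodBernoulli w with hμ
  set D : Set (BondConfig V) := {ω : BondConfig V | ∀ x ∈ X, ¬ (openGraph ω).Reachable s x} with hD
  set T : Set (BondConfig V) := {ω : BondConfig V | ∀ x ∈ insert s X, ¬ (openGraph ω).Reachable y x} ∩ D with hT
  set Yv : Set (BondConfig V) := openConn s y with hYv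
  set Zv : Set (BondConfig V) := openConn s z with hZv
  set Wv : Set (BondConfig V) := openConn y z with hWv
  set f : BondConfig V → ℝ := fun ω => F (openEdgeCluster ω s) with hf
  have hlink := linkedMarker_ge w s y z X F hF hF0
  have hP1 := markerPA_ge w s y z X F hF
  have hmeas : ∀ S : Set (BondConfig V), MeasurableSet S := fun _ => MeasurableSet.of_discrete
  have h0 : ∀ S : Set (BondConfig V), 0 ≤ μ.real S := fun _ => measureReal_nonneg
  -- linear relations between the pieces
  have hI : (∫ ω in D ∩ Yv, f ω ∂μ) + (∫ ω in D ∩ Yvᶜ, f ω ∂μ) = ∫ ω in D, f ω ∂μ := setIntegral_inter_add_compl w D Yv f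
  have hK : (∫ ω in D ∩ Yv, (1 - f ω) ∂μ) + (∫ ω in D ∩ Yvᶜ, (1 - f ω) ∂μ) = ∫ ω in D, (1 - f ω) ∂μ :=
    setIntegral_inter_add_compl w D Yv (fun ω => 1 - f ω)
  have hIZ : (∫ ω in D ∩ Yv ∩ Zv, f ω ∂μ) + (∫ ω in D ∩ Yvᶜ ∩ Zv, f ω ∂μ) = ∫ ω in D ∩ Zv, f ω ∂μ := by
    have h := setIntegral_inter_add_compl w (D ∩ Zv) Yv f
    rw [show D ∩ Zv ∩ Yv = D ∩ Yv ∩ Zv from inter_right_comm D Zv Yv,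
      show D ∩ Zv ∩ Yvᶜ = D ∩ Yvᶜ ∩ Zv from inter_right_comm D Zv Yvᶜ] at h
    exact h
  have hKY : (∫ ω in D ∩ Yv, (1 - f ω) ∂μ) = μ.real (D ∩ Yv) - ∫ ω in D ∩ Yv, f ω ∂μ := setIntegral_one_sub w (D ∩ Yv) f
  have hKYZ : (∫ ω in D ∩ Yv ∩ Zv, (1 - f ω) ∂μ) = μ.real (D ∩ Yv ∩ Zv) - ∫ ω in D ∩ Yv ∩ Zv, f ω ∂μ :=
    setIntegral_one_sub w (D ∩ Yv ∩ Zv) f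
  have hKNe : (∫ ω in D ∩ Yvᶜ, (1 - f ω) ∂μ) = μ.real (D ∩ Yvᶜ) - ∫ ω in D ∩ Yvᶜ, f ω ∂μ := setIntegral_one_sub w (D ∩ Yvᶜ) f
  have hKNZ : (∫ ω in D ∩ Yvᶜ ∩ Zv, (1 - f ω) ∂μ) = μ.real (D ∩ Yvᶜ ∩ Zv) - ∫ ω in D ∩ Yvᶜ ∩ Zv, f ω ∂μ :=
    setIntegral_one_sub w (D ∩ Yvᶜ ∩ Zv) f
  have hKD : (∫ ω in D, (1 - f ω) ∂μ) = μ.real D - ∫ ω in D, f ω ∂μ := setIntegral_one_sub w D f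
  have hmY : μ.real (D ∩ Yv) + μ.real (D ∩ Yvᶜ) = μ.real D := by
    have h := measureReal_inter_add_sdiff (μ := μ) (s := D) (MeasurableSet.of_discrete : MeasurableSet Yv)
    rwa [Set.sdiff_eq] at h
  have hmZ : μ.real (D ∩ Yv ∩ Zv) + μ.real (D ∩ Yvᶜ ∩ Zv) = μ.real (D ∩ Zv) := by
    have h := measureReal_inter_add_sdiff (μ := μ) (s := D ∩ Zv) (MeasurableSet.of_discrete : MeasurableSet Yv)
    rw [Set.sdiff_eq, show D ∩ Zv ∩ Yv = D ∩ Yv ∩ Zv from inter_right_comm D Zv Yv,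
      show D ∩ Zv ∩ Yvᶜ = D ∩ Yvᶜ ∩ Zv from inter_right_comm D Zv Yvᶜ] at h
    exact h
  -- nonnegativity
  have hIY0 : 0 ≤ ∫ ω in D ∩ Yv, f ω ∂μ := setIntegral_nonneg (hmeas _) fun ω _ => hF0 _
  have hK0 : 0 ≤ ∫ ω in D, (1 - f ω) ∂μ := setIntegral_nonneg (hmeas _) fun ω _ => sub_nonneg.2 (hF1 _)
  have hKN0 : 0 ≤ ∫ ω in D ∩ Yvᶜ, (1 - f ω) ∂μ := hKN.le
  -- C2 ≥ I_Y · Θ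
  have hC2 : (∫ ω in D ∩ Yv, f ω ∂μ) * ((∫ ω in D ∩ Yvᶜ, (1 - f ω) ∂μ) * μ.real (T ∩ Zv) -
      μ.real T * ∫ ω in D ∩ Yvᶜ ∩ Zv, (1 - f ω) ∂μ) ≤
      μ.real T * (∫ ω in D ∩ Yvᶜ, (1 - f ω) ∂μ) * (∫ ω in D ∩ Yv ∩ Zv, f ω ∂μ) -
        (μ.real (T ∩ Wv) * (∫ ω in D ∩ Yvᶜ, (1 - f ω) ∂μ) + μ.real T * (∫ ω in D ∩ Yvᶜ ∩ Zv, (1 - f ω) ∂μ)) *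
          (∫ ω in D ∩ Yv, f ω ∂μ) := by
    nlinarith [mul_le_mul_of_nonneg_left hlink hKN0]
  -- the split identity, multiplied out
  have hid : (∫ ω in D ∩ Yvᶜ, (1 - f ω) ∂μ) *
      (μ.real T * (μ.real D * (∫ ω in D ∩ Zv, f ω ∂μ) - (∫ ω in D, f ω ∂μ) * μ.real (D ∩ Zv)) -
        μ.real (T ∩ Wv) * (μ.real D * (∫ ω in D ∩ Yv, f ω ∂μ) - (∫ ω in D, f ω ∂μ) * μ.real (D ∩ Yv))) =
      (∫ ω in D, (1 - f ω) ∂μ) *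
          (μ.real T * (∫ ω in D ∩ Yvᶜ, (1 - f ω) ∂μ) * (∫ ω in D ∩ Yv ∩ Zv, f ω ∂μ) -
            (μ.real (T ∩ Wv) * (∫ ω in D ∩ Yvᶜ, (1 - f ω) ∂μ) + μ.real T * (∫ ω in D ∩ Yvᶜ ∩ Zv, (1 - f ω) ∂μ)) *
              (∫ ω in D ∩ Yv, f ω ∂μ)) -
        (∫ ω in D, f ω ∂μ) *
          (μ.real T * (∫ ω in D ∩ Yvᶜ, (1 - f ω) ∂μ) * (∫ ω in D ∩ Yv ∩ Zv, (1 - f ω) ∂μ) -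
            (μ.real (T ∩ Wv) * (∫ ω in D ∩ Yvᶜ, (1 - f ω) ∂μ) + μ.real T * (∫ ω in D ∩ Yvᶜ ∩ Zv, (1 - f ω) ∂μ)) *
              (∫ ω in D ∩ Yv, (1 - f ω) ∂μ)) +
        (∫ ω in D, (1 - f ω) ∂μ) * μ.real T *
          (μ.real (D ∩ Yvᶜ) * (∫ ω in D ∩ Yvᶜ ∩ Zv, f ω ∂μ) - μ.real (D ∩ Yvᶜ ∩ Zv) * (∫ ω in D ∩ Yvᶜ, f ω ∂μ)) := by
    rw [← hIZ, ← hmZ, ← hI, ← hmY, hKY, hKYZ, hKNZ]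
    rw [← hI, ← hmY] at hKD
    rw [hKD, hKNe]
    ring
  have hT0 := h0 T
  have key : 0 ≤ (∫ ω in D ∩ Yvᶜ, (1 - f ω) ∂μ) *
      (μ.real T * (μ.real D * (∫ ω in D ∩ Zv, f ω ∂μ) - (∫ ω in D, f ω ∂μ) * μ.real (D ∩ Zv)) -
        μ.real (T ∩ Wv) * (μ.real D * (∫ ω in D ∩ Yv, f ω ∂μ) - (∫ ω in D, f ω ∂μ) * μ.real (D ∩ Yv))) := by
    rw [hid]
    nlinarith [mul_le_mul_of_nonneg_left hC2 hK0, hcond, mul_nonneg (mul_nonneg hK0 hT0) (sub_nonneg.2 hP1)]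
  have key' := (mul_nonneg_iff_of_pos_left hKN).1 key
  linarith [key']

end Consts

end Summit.CriticalPhenomena.PercolationContinuityZ3.Theorems

end
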